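import Mathlib.RingTheory.Polynomial.Resultant.Basic
import Mathlib.RingTheory.Polynomial.Basic
import Mathlib.RingTheory.Localization.FractionRing
import Mathlib.Algebra.MvPolynomial.CommRing
import Mathlib.FieldTheory.IsAlgClosed.Basic
import HarnessLib

/-!
# The resultant of two binomials: `R(x^r − α, x^s − β) = (−1)^s [α^{s₁} − β^{r₁}]^d`, `d = (r, s)` — Swan, *Factorization of polynomials over finite fields*, Lemma 3

Topic `Literature/Algebra/Polynomial`, namespace `Literature.Algebra.Polynomial.ResultantBinomials`
(lane `lit-semireg`, literature-prover hsemireg-lit-8 g31).  Everything here is **proved**; theorems only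
(no `def`, no named fact, no instance, no notation).  The resultant is Mathlib's Sylvester-matrix
`Polynomial.resultant f g m n` (`Mathlib.RingTheory.Polynomial.Resultant.Basic`), which has the Euclidean
calculus (`resultant_add_mul_left`, `resultant_C_mul_left`, `resultant_comm`, …) but no closed form for two
binomials; this file supplies Swan's closed form, the computation feeding the discriminant of a trinomial
(Swan's Theorem 2, typed in the sequel `DiscriminantTrinomialSwan`).

Source, verbatim.  R. G. Swan, *Factorization of polynomials over finite fields*, Pacific J. Math. **12**
(1962), 1099–1106 (held `paper:doi-10-2140-pjm-1962-12-1099`), § 3, p. 1104: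

> «Let `f` and `g` be any polynomials over any field `F`. Let `g` have roots `β_1, …, β_m` (counted with
> multiplicity), and leading coefficient `b`. Let `n` be the degree of `f(x)`. Then the resultant of `f`
> and `g` is defined to be `R(f, g) = bⁿ ∏_{j=1}^{m} f(β_j)`.»
> «LEMMA 2. (1) `R(g, f) = (−1)^{deg f · deg g} R(f, g)` (2) If `f = gq + r`,
> `R(f, g) = b^{deg f − deg r} R(r, g)` where `b` is the leading coefficient of `g`. (3) If `a` and `b` are
> constants not both `0`, `R(a, b) = 1`. (4) `R(f₁f₂, g) = R(f₁, g)R(f₂, g)`. …»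
> «In order to compute the discriminant of a trinomial, it is first necessary to compute the resultant
> of two binomials.
> LEMMA 3. Let `d = (r, s)` be the greatest common divisor of `r` and `s`. Let `r = dr₁`, `s = ds₁`. Then
> `R(x^r − α, x^s − β) = (−1)^s [α^{s₁} − β^{r₁}]^d`.
> Proof. We first observe that if the result holds for a given pair `(r, s)` it holds for `(s, r)`. This
> follows easily from Lemma 2 (1) using the fact `rs + s + d ≡ r mod 2`.  Since the result is trivial
> for `s = 0`, we can prove it by induction on `r + s`, assuming also `r ≥ s` by the previous remark.
> Now, dividing `x^r − α` by `x^s − β` gives the remainder `βx^{r−s} − α`. Thus we can apply Lemma 2 (2)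
> and the result follows easily by induction.» (p. 1104–1105)

## Dictionary

Swan's `R(f, g) = lc(g)^{deg f} ∏_{g(β)=0} f(β)` is Mathlib's `Polynomial.resultant g f (deg g) (deg f)`
(`Polynomial.resultant_eq_prod_eval`: `resultant f g = lc(f)^{deg g} ∏_{f(α)=0} g(α)`), i.e. the two
conventions differ by the swap of Lemma 2 (1) (`Polynomial.resultant_comm`).  Hence Lemma 3 reads, for
Mathlib's resultant and after renaming `(s, β, r, α) ↦ (m, a, n, b)`,
`resultant (X^m − C a) (X^n − C b) m n = (−1)^m (b^{m/d} − a^{n/d})^d`, `d = gcd(m, n)` — this is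
`resultant_X_pow_sub_C_X_pow_sub_C`; the literal product form of the definition is
`prod_roots_X_pow_sub_C_pow_sub`.

## The proof typed here

Swan's induction, run over a field for NONZERO `α, β` (a class stable under the two moves `(α, β) ↦ (β, α)`
and `(α, β) ↦ (α/β, β)`): the Euclidean step is Mathlib's `resultant_add_mul_left` followed by
`resultant_add_left_deg` and `resultant_C_mul_left` (`resultant_step`), the swap is `resultant_comm` with the
parity `rs + s + d ≡ r (mod 2)` (`even_mul_add_add_gcd_add`).  The identity for ARBITRARY `α, β` in an
ARBITRARY commutative ring then follows for free by specialising the universal case `ℤ[A, B]`, which embeds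
in its (characteristic-`0`) fraction field (`resultant_map_map` in both directions).  The version with
arbitrary leading coefficients (`resultant_C_mul_X_pow_add_C`, ours, from Lemma 3 with Lemma 2 (4)/(6)) is
obtained the same way from `ℤ[U, V, P, Q]`.

## What is typed (all `theorem`s)

* **`resultant_X_pow_sub_C_X_pow_sub_C`** — Lemma 3 for Mathlib's resultant, any commutative ring, all
  `m n : ℕ` (with `ℕ`-division conventions the formula is correct also for `m = 0` or `n = 0`);
* `resultant_X_pow_sub_C_X_pow_sub_C_of_coprime` — the case `d = 1`: `(−1)^m (b^m − a^n)`;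
* **`prod_roots_X_pow_sub_C_pow_sub`** — the statement as printed: over a field in which `x^s − β` splits
  (`s ≥ 1`), `∏_{γ^s = β} (γ^r − α) = (−1)^s (α^{s/d} − β^{r/d})^d`;
* **`resultant_C_mul_X_pow_add_C`** — general binomials `uX^m + v`, `pX^n + q` over any commutative ring:
  `resultant = (−1)^m ((−1)^{m/d} u^{n/d} q^{m/d} − (−1)^{n/d} p^{m/d} v^{n/d})^d`.

Honest scope / deviations.  Printed over a field; typed over any commutative ring (the field case with
`α β ≠ 0` is the engine, the rest is specialisation of the generic identity).  Lemma 2 is Mathlib's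
(`resultant_comm`, `resultant_add_mul_left`, `resultant_C_left/right`, `resultant_mul_left`) and is not
restated.  DEDUP: `rg "X \^ . - C .*resultant|resultant.*X \^ . - C" Literature` → nothing; Mathlib has
`resultant_X_pow_left/right`, `resultant_X_sub_C_pow_left/right` (one argument a power of a linear form)
only.

## References
* [Swan1962] R. G. Swan, *Factorization of polynomials over finite fields*, Pacific J. Math. 12 (1962),
  1099–1106, § 3, Lemma 2, Lemma 3.
-/

open Polynomial

namespace Literature.Algebra.Polynomial.ResultantBinomials

/-! ## § 0 Parity and small helpers -/

/-- Powers of `−1` with exponents of the same parity agree. [folklore] -/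
private theorem neg_one_pow_congr {R : Type*} [Ring R] {i j : ℕ} (h : Even (i + j)) :
    (-1 : R) ^ i = (-1) ^ j := by
  rw [neg_one_pow_eq_pow_mod_two (R := R) (n := i), neg_one_pow_eq_pow_mod_two (R := R) (n := j)]
  obtain ⟨c, hc⟩ := h
  congr 1
  omega

/-- Swan's parity remark in the proof of Lemma 3: `rs + s + d ≡ r (mod 2)` for `d = (r, s)`.
[cite: Swan1962, Lemma 3, proof] -/
theorem even_mul_add_add_gcd_add (r s : ℕ) : Even (r * s + s + Nat.gcd r s + r) := by
  rcases Nat.even_or_odd r with hr | hr <;> rcases Nat.even_or_odd s with hs | hs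
  · have hd : Even (Nat.gcd r s) :=
      even_iff_two_dvd.2 (Nat.dvd_gcd (even_iff_two_dvd.1 hr) (even_iff_two_dvd.1 hs))
    simp [Nat.even_add, hr, hs, hd]
  · have hd : ¬ Even (Nat.gcd r s) :=
      Nat.not_even_iff_odd.2 (hs.of_dvd_nat (Nat.gcd_dvd_right r s))
    have hs' : ¬ Even s := Nat.not_even_iff_odd.2 hs
    simp [Nat.even_add, hr, hs', hd]
  · have hd : ¬ Even (Nat.gcd r s) :=
      Nat.not_even_iff_odd.2 (hr.of_dvd_nat (Nat.gcd_dvd_left r s))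
    have hr' : ¬ Even r := Nat.not_even_iff_odd.2 hr
    simp [Nat.even_add, hr', hs, hd]
  · have hd : ¬ Even (Nat.gcd r s) :=
      Nat.not_even_iff_odd.2 (hr.of_dvd_nat (Nat.gcd_dvd_left r s))
    have hr' : ¬ Even r := Nat.not_even_iff_odd.2 hr
    have hs' : ¬ Even s := Nat.not_even_iff_odd.2 hs
    simp [Nat.even_add, Nat.even_mul, hr', hs', hd]

/-- Base change of a binomial `X^m − C a`. [folklore] -/
private theorem map_X_pow_sub_C {R S : Type*} [CommRing R] [CommRing S] (φ : R →+* S) (m : ℕ)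
    (a : R) : (X ^ m - C a : R[X]).map φ = X ^ m - C (φ a) := by
  rw [Polynomial.map_sub, Polynomial.map_pow, map_X, map_C]

/-- Base change of a binomial `C u * X^m + C v`. [folklore] -/
private theorem map_C_mul_X_pow_add_C {R S : Type*} [CommRing R] [CommRing S] (φ : R →+* S)
    (m : ℕ) (u v : R) : (C u * X ^ m + C v : R[X]).map φ = C (φ u) * X ^ m + C (φ v) := by
  rw [Polynomial.map_add, Polynomial.map_mul, Polynomial.map_pow, map_X, map_C, map_C]

/-- The universal specialisation `ℤ[A, B] → R`, `A ↦ a`, `B ↦ b`. [folklore] -/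
private theorem exists_hom₂ {R : Type*} [CommRing R] (a b : R) :
    ∃ φ : MvPolynomial (Fin 2) ℤ →+* R, φ (MvPolynomial.X 0) = a ∧ φ (MvPolynomial.X 1) = b :=
  ⟨MvPolynomial.eval₂Hom (Int.castRingHom R) ![a, b],
    by rw [MvPolynomial.eval₂Hom_X']; rfl, by rw [MvPolynomial.eval₂Hom_X']; rfl⟩

/-- The universal specialisation `ℤ[U, V, P, Q] → R`. [folklore] -/
private theorem exists_hom₄ {R : Type*} [CommRing R] (u v p q : R) :
    ∃ φ : MvPolynomial (Fin 4) ℤ →+* R, φ (MvPolynomial.X 0) = u ∧ φ (MvPolynomial.X 1) = v ∧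
      φ (MvPolynomial.X 2) = p ∧ φ (MvPolynomial.X 3) = q :=
  ⟨MvPolynomial.eval₂Hom (Int.castRingHom R) ![u, v, p, q],
    by rw [MvPolynomial.eval₂Hom_X']; rfl, by rw [MvPolynomial.eval₂Hom_X']; rfl,
    by rw [MvPolynomial.eval₂Hom_X']; rfl, by rw [MvPolynomial.eval₂Hom_X']; rfl⟩

/-! ## § 1 Swan's induction over a field, nonzero constants -/

section Field

variable {K : Type*} [Field K]

/-- **The Euclidean step** («dividing `x^r − α` by `x^s − β` gives the remainder `βx^{r−s} − α`»,
then Lemma 2 (2) and pulling out the constant `β`): for `s ≥ 1`, `β ≠ 0`,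
`Res_{s+t,s}(X^{s+t} − α, X^s − β) = (−1)^s β^s · Res_{t,s}(X^t − α/β, X^s − β)`.
[cite: Swan1962, Lemma 3, proof] -/
theorem resultant_step (a b : K) (hb : b ≠ 0) (t s : ℕ) (hs : 0 < s) :
    resultant (X ^ (s + t) - C a) (X ^ s - C b) (s + t) s =
      (-1) ^ s * b ^ s * resultant (X ^ t - C (a / b)) (X ^ s - C b) t s := by
  have h1 : (X ^ (s + t) - C a : K[X]) = (C b * X ^ t - C a) + (X ^ s - C b) * X ^ t := by
    rw [pow_add]; ring
  have hp : (X ^ t : K[X]).natDegree + s ≤ s + t := by rw [natDegree_X_pow]; omega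
  have hg : (X ^ s - C b : K[X]).natDegree ≤ s := by rw [natDegree_X_pow_sub_C]
  rw [h1, resultant_add_mul_left _ _ _ _ _ hp hg]
  have hf : (C b * X ^ t - C a : K[X]).natDegree ≤ t := by
    refine (natDegree_sub_le _ _).trans ?_
    rw [natDegree_C, Nat.max_zero]
    exact natDegree_C_mul_X_pow_le b t
  rw [add_comm s t, resultant_add_left_deg _ _ _ _ _ hf]
  have hc : (X ^ s - C b : K[X]).coeff s = 1 := by
    rw [coeff_sub, coeff_X_pow_self, coeff_C, if_neg hs.ne', sub_zero]
  have h2 : (C b * X ^ t - C a : K[X]) = C b * (X ^ t - C (a / b)) := by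
    rw [mul_sub, ← C_mul, mul_div_assoc', mul_div_cancel_left₀ _ hb]
  rw [hc, one_pow, mul_one, h2, resultant_C_mul_left, ← mul_assoc,
    neg_one_pow_congr (R := K) (i := s * s) (j := s)
      (by rw [← Nat.mul_succ]; exact Nat.even_mul_succ_self s)]

/-- **Lemma 3 over a field for nonzero constants, by Swan's induction on `r + s`** (the case `s ≤ r`
by the Euclidean step, the case `r < s` by the swap `Res(f, g) = (−1)^{rs} Res(g, f)` and
`rs + s + d ≡ r (mod 2)`; base `s = 0`: `Res(x^r − α, 1 − β) = (1 − β)^r`).  Mathlib orientation: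
`resultant (X^r − C a) (X^s − C b) r s = (−1)^r (b^{r/d} − a^{s/d})^d`.
[cite: Swan1962, Lemma 3] -/
theorem resultant_X_pow_sub_C_X_pow_sub_C_of_ne_zero (N : ℕ) :
    ∀ r s : ℕ, r + s = N → ∀ a b : K, a ≠ 0 → b ≠ 0 →
      resultant (X ^ r - C a) (X ^ s - C b) r s =
        (-1) ^ r * (b ^ (r / Nat.gcd r s) - a ^ (s / Nat.gcd r s)) ^ Nat.gcd r s := by
  induction N using Nat.strong_induction_on with
  | _ N IH =>
  -- the case `s ≤ r`
  have key : ∀ r s : ℕ, r + s = N → s ≤ r → ∀ a b : K, a ≠ 0 → b ≠ 0 →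
      resultant (X ^ r - C a) (X ^ s - C b) r s =
        (-1) ^ r * (b ^ (r / Nat.gcd r s) - a ^ (s / Nat.gcd r s)) ^ Nat.gcd r s := by
    intro r s hN hsr a b ha hb
    rcases Nat.eq_zero_or_pos s with rfl | hs
    · -- `s = 0`: `Res(X^r − a, 1 − b) = (1 − b)^r`
      rw [pow_zero, ← C_1, ← C_sub, resultant_C_right, pow_zero, one_mul, Nat.gcd_zero_right,
        Nat.zero_div, pow_zero]
      rcases Nat.eq_zero_or_pos r with rfl | hr
      · simp
      · rw [Nat.div_self hr, pow_one, ← mul_pow, neg_one_mul, neg_sub]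
    · obtain ⟨t, rfl⟩ := Nat.exists_eq_add_of_le hsr
      rw [resultant_step a b hb t s hs,
        IH (t + s) (by omega) t s rfl (a / b) b (div_ne_zero ha hb) hb, Nat.gcd_self_add_left]
      set d := Nat.gcd t s with hd
      have hd0 : 0 < d := Nat.gcd_pos_of_pos_right _ hs
      obtain ⟨t₁, ht⟩ := Nat.gcd_dvd_left t s
      obtain ⟨s₁, hs1⟩ := Nat.gcd_dvd_right t s
      rw [← hd] at ht hs1
      have hq1 : t / d = t₁ := by rw [ht, Nat.mul_div_cancel_left _ hd0]
      have hq2 : s / d = s₁ := by rw [hs1, Nat.mul_div_cancel_left _ hd0]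
      have hq3 : (s + t) / d = s₁ + t₁ := by
        rw [hs1, ht, ← mul_add, Nat.mul_div_cancel_left _ hd0]
      rw [hq1, hq2, hq3]
      have h3 : b ^ s₁ * (b ^ t₁ - (a / b) ^ s₁) = b ^ (s₁ + t₁) - a ^ s₁ := by
        rw [div_pow, mul_sub, ← pow_add, mul_div_assoc',
          mul_div_cancel_left₀ _ (pow_ne_zero _ hb)]
      have hbs : b ^ s = (b ^ s₁) ^ d := by rw [← pow_mul, mul_comm, ← hs1]
      rw [hbs, ← h3, mul_pow, pow_add]
      ring
  intro r s hN a b ha hb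
  rcases le_or_gt s r with hsr | hrs
  · exact key r s hN hsr a b ha hb
  · -- the case `r < s`: swap
    rw [resultant_comm, key s r (by omega) hrs.le b a hb ha, Nat.gcd_comm s r]
    set d := Nat.gcd r s
    rw [show a ^ (s / d) - b ^ (r / d) = -(b ^ (r / d) - a ^ (s / d)) by ring,
      neg_pow (b ^ (r / d) - _)]
    linear_combination (b ^ (r / d) - a ^ (s / d)) ^ d *
      neg_one_pow_congr (R := K) (i := r * s + s + d) (j := r) (even_mul_add_add_gcd_add r s)

end Field

/-! ## § 2 Lemma 3 over an arbitrary commutative ring -/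

section CommRing

variable {R : Type*} [CommRing R]

/-- **Swan's Lemma 3 (the resultant of two binomials), for Mathlib's resultant over any commutative
ring.** «Let `d = (r, s)` be the greatest common divisor of `r` and `s`. Let `r = dr₁`, `s = ds₁`. Then
`R(x^r − α, x^s − β) = (−1)^s [α^{s₁} − β^{r₁}]^d`», where `R(f, g) = lc(g)^{deg f} ∏_{g(β)=0} f(β)` is
Mathlib's `resultant g f`; renamed `(s, β, r, α) ↦ (m, a, n, b)`:
`Res_{m,n}(X^m − a, X^n − b) = (−1)^m (b^{m/d} − a^{n/d})^d`, `d = gcd(m, n)` (all `m, n ∈ ℕ`, with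
`0/0 = 0`).  Obtained from the field case by specialising the universal identity over `ℤ[A, B]`.
[cite: Swan1962, Lemma 3] -/
theorem resultant_X_pow_sub_C_X_pow_sub_C (m n : ℕ) (a b : R) :
    resultant (X ^ m - C a) (X ^ n - C b) m n =
      (-1) ^ m * (b ^ (m / Nat.gcd m n) - a ^ (n / Nat.gcd m n)) ^ Nat.gcd m n := by
  -- the identity in the universal ring `ℤ[A, B]`, through its fraction field
  have key : resultant (X ^ m - C (MvPolynomial.X 0 : MvPolynomial (Fin 2) ℤ))
      (X ^ n - C (MvPolynomial.X 1 : MvPolynomial (Fin 2) ℤ)) m n =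
      (-1) ^ m * ((MvPolynomial.X 1 : MvPolynomial (Fin 2) ℤ) ^ (m / Nat.gcd m n) -
        (MvPolynomial.X 0 : MvPolynomial (Fin 2) ℤ) ^ (n / Nat.gcd m n)) ^ Nat.gcd m n := by
    have hι : Function.Injective
        (algebraMap (MvPolynomial (Fin 2) ℤ) (FractionRing (MvPolynomial (Fin 2) ℤ))) :=
      IsFractionRing.injective _ _
    apply hι
    rw [← resultant_map_map, map_X_pow_sub_C, map_X_pow_sub_C,
      resultant_X_pow_sub_C_X_pow_sub_C_of_ne_zero (m + n) m n rfl _ _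
        ((map_ne_zero_iff _ hι).2 (MvPolynomial.X_ne_zero 0))
        ((map_ne_zero_iff _ hι).2 (MvPolynomial.X_ne_zero 1))]
    simp only [map_mul, map_pow, map_sub, map_neg, map_one]
  obtain ⟨φ, h0, h1⟩ := exists_hom₂ a b
  have h := congr_arg φ key
  rw [← resultant_map_map, map_X_pow_sub_C, map_X_pow_sub_C, h0, h1] at h
  rw [h]
  simp only [map_mul, map_pow, map_sub, map_neg, map_one, h0, h1]

/-- The coprime case `d = 1` of Lemma 3: `Res_{m,n}(X^m − a, X^n − b) = (−1)^m (b^m − a^n)`.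
[cite: Swan1962, Lemma 3] -/
theorem resultant_X_pow_sub_C_X_pow_sub_C_of_coprime {m n : ℕ} (h : Nat.Coprime m n) (a b : R) :
    resultant (X ^ m - C a) (X ^ n - C b) m n = (-1) ^ m * (b ^ m - a ^ n) := by
  rw [resultant_X_pow_sub_C_X_pow_sub_C, Nat.Coprime.gcd_eq_one h, Nat.div_one, Nat.div_one, pow_one]

/-- **Lemma 3 for binomials with arbitrary leading coefficients** (ours; from Lemma 3 and Lemma 2 (4),
(6): pull out the constants `u`, `p`): over any commutative ring,
`Res_{m,n}(uX^m + v, pX^n + q) = (−1)^m ((−1)^{m/d} u^{n/d} q^{m/d} − (−1)^{n/d} p^{m/d} v^{n/d})^d`,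
`d = gcd(m, n)`. [cite: Swan1962, Lemma 3 with Lemma 2 (4), (6)] -/
theorem resultant_C_mul_X_pow_add_C (m n : ℕ) (u v p q : R) :
    resultant (C u * X ^ m + C v) (C p * X ^ n + C q) m n =
      (-1) ^ m * ((-1) ^ (m / Nat.gcd m n) * u ^ (n / Nat.gcd m n) * q ^ (m / Nat.gcd m n) -
        (-1) ^ (n / Nat.gcd m n) * p ^ (m / Nat.gcd m n) * v ^ (n / Nat.gcd m n)) ^ Nat.gcd m n := by
  -- over a field with `u p ≠ 0`: pull out the constants and use Lemma 3
  have hF : ∀ {F : Type} [Field F] (u v p q : F), u ≠ 0 → p ≠ 0 →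
      resultant (C u * X ^ m + C v) (C p * X ^ n + C q) m n =
        (-1) ^ m * ((-1) ^ (m / Nat.gcd m n) * u ^ (n / Nat.gcd m n) * q ^ (m / Nat.gcd m n) -
          (-1) ^ (n / Nat.gcd m n) * p ^ (m / Nat.gcd m n) * v ^ (n / Nat.gcd m n)) ^
            Nat.gcd m n := by
    intro F _ u v p q hu hp
    have h1 : (C u * X ^ m + C v : F[X]) = C u * (X ^ m - C (-v / u)) := by
      rw [mul_sub, ← C_mul, mul_div_assoc', mul_div_cancel_left₀ _ hu, C_neg, sub_neg_eq_add]
    have h2 : (C p * X ^ n + C q : F[X]) = C p * (X ^ n - C (-q / p)) := by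
      rw [mul_sub, ← C_mul, mul_div_assoc', mul_div_cancel_left₀ _ hp, C_neg, sub_neg_eq_add]
    rw [h1, h2, resultant_C_mul_left, resultant_C_mul_right, resultant_X_pow_sub_C_X_pow_sub_C]
    set d := Nat.gcd m n with hd
    obtain ⟨m₁, hm⟩ := Nat.gcd_dvd_left m n
    obtain ⟨n₁, hn⟩ := Nat.gcd_dvd_right m n
    rw [← hd] at hm hn
    rcases Nat.eq_zero_or_pos d with hd0 | hd0
    · -- `d = 0`, i.e. `m = n = 0`
      have hm0 : m = 0 := by rw [hm, hd0, zero_mul]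
      have hn0 : n = 0 := by rw [hn, hd0, zero_mul]
      subst hm0 hn0
      simp [hd0]
    have hq1 : m / d = m₁ := by rw [hm, Nat.mul_div_cancel_left _ hd0]
    have hq2 : n / d = n₁ := by rw [hn, Nat.mul_div_cancel_left _ hd0]
    rw [hq1, hq2]
    have hu' : u ^ n = (u ^ n₁) ^ d := by rw [← pow_mul, mul_comm, ← hn]
    have hp' : p ^ m = (p ^ m₁) ^ d := by rw [← pow_mul, mul_comm, ← hm]
    have h3 : u ^ n₁ * p ^ m₁ * ((-q / p) ^ m₁ - (-v / u) ^ n₁) =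
        (-1) ^ m₁ * u ^ n₁ * q ^ m₁ - (-1) ^ n₁ * p ^ m₁ * v ^ n₁ := by
      rw [div_pow, div_pow, neg_pow q, neg_pow v, mul_sub]
      rw [show u ^ n₁ * p ^ m₁ * ((-1) ^ m₁ * q ^ m₁ / p ^ m₁) =
          (-1) ^ m₁ * u ^ n₁ * (p ^ m₁ * q ^ m₁ / p ^ m₁) by ring,
        show u ^ n₁ * p ^ m₁ * ((-1) ^ n₁ * v ^ n₁ / u ^ n₁) =
          (-1) ^ n₁ * p ^ m₁ * (u ^ n₁ * v ^ n₁ / u ^ n₁) by ring,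
        mul_div_cancel_left₀ _ (pow_ne_zero _ hp), mul_div_cancel_left₀ _ (pow_ne_zero _ hu)]
    rw [hu', hp', ← h3, mul_pow, mul_pow]
    ring
  -- the identity in the universal ring `ℤ[U, V, P, Q]`, through its fraction field
  have key : resultant (C (MvPolynomial.X 0 : MvPolynomial (Fin 4) ℤ) * X ^ m + C (MvPolynomial.X 1))
      (C (MvPolynomial.X 2 : MvPolynomial (Fin 4) ℤ) * X ^ n + C (MvPolynomial.X 3)) m n =
      (-1) ^ m * ((-1) ^ (m / Nat.gcd m n) *
        (MvPolynomial.X 0 : MvPolynomial (Fin 4) ℤ) ^ (n / Nat.gcd m n) *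
          (MvPolynomial.X 3) ^ (m / Nat.gcd m n) -
        (-1) ^ (n / Nat.gcd m n) * (MvPolynomial.X 2) ^ (m / Nat.gcd m n) *
          (MvPolynomial.X 1) ^ (n / Nat.gcd m n)) ^ Nat.gcd m n := by
    have hι : Function.Injective
        (algebraMap (MvPolynomial (Fin 4) ℤ) (FractionRing (MvPolynomial (Fin 4) ℤ))) :=
      IsFractionRing.injective _ _
    apply hι
    rw [← resultant_map_map, map_C_mul_X_pow_add_C, map_C_mul_X_pow_add_C,
      hF _ _ _ _ ((map_ne_zero_iff _ hι).2 (MvPolynomial.X_ne_zero 0))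
        ((map_ne_zero_iff _ hι).2 (MvPolynomial.X_ne_zero 2))]
    simp only [map_mul, map_pow, map_sub, map_neg, map_one]
  obtain ⟨φ, h0, h1, h2, h3⟩ := exists_hom₄ u v p q
  have h := congr_arg φ key
  rw [← resultant_map_map, map_C_mul_X_pow_add_C, map_C_mul_X_pow_add_C, h0, h1, h2, h3] at h
  rw [h]
  simp only [map_mul, map_pow, map_sub, map_neg, map_one, h0, h1, h2, h3]

end CommRing

/-! ## § 3 The statement as printed: a product over the roots of `x^s − β` -/

section Split

variable {K : Type*} [Field K]

/-- **Lemma 3 in the printed form** `R(x^r − α, x^s − β) = ∏_{j} (β_j^r − α) = (−1)^s [α^{s₁} − β^{r₁}]^d`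
(`β_1, …, β_s` the roots of `x^s − β` with multiplicity, `s ≥ 1`, in a field where `x^s − β` splits —
e.g. an algebraically closed field; `d = (r, s)`, `r₁ = r/d`, `s₁ = s/d`).
[cite: Swan1962, Lemma 3] -/
theorem prod_roots_X_pow_sub_C_pow_sub (r : ℕ) {s : ℕ} (hs : 0 < s) (α β : K)
    (hsplit : (X ^ s - C β : K[X]).Splits) :
    ((X ^ s - C β : K[X]).roots.map fun γ => γ ^ r - α).prod =
      (-1) ^ s * (α ^ (s / Nat.gcd r s) - β ^ (r / Nat.gcd r s)) ^ Nat.gcd r s := by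
  have h := resultant_eq_prod_eval (X ^ s - C β) (X ^ r - C α) r (natDegree_X_pow_sub_C.le) hsplit
  rw [natDegree_X_pow_sub_C, (monic_X_pow_sub_C β hs.ne').leadingCoeff, one_pow, one_mul,
    resultant_X_pow_sub_C_X_pow_sub_C, Nat.gcd_comm s r] at h
  rw [h]
  refine congr_arg _ (Multiset.map_congr rfl fun γ _ => ?_)
  rw [eval_sub, eval_pow, eval_X, eval_C]

/-- The same over the splitting data of `x^s − β` in an algebraically closed field: no hypothesis.
[cite: Swan1962, Lemma 3] -/
theorem prod_roots_X_pow_sub_C_pow_sub_of_isAlgClosed [IsAlgClosed K] (r : ℕ) {s : ℕ} (hs : 0 < s)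
    (α β : K) :
    ((X ^ s - C β : K[X]).roots.map fun γ => γ ^ r - α).prod =
      (-1) ^ s * (α ^ (s / Nat.gcd r s) - β ^ (r / Nat.gcd r s)) ^ Nat.gcd r s :=
  prod_roots_X_pow_sub_C_pow_sub r hs α β (IsAlgClosed.splits _)

end Split

end Literature.Algebra.Polynomial.ResultantBinomials
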